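import Mathlib
import HarnessLib
import Summits.HubbardSuperconductivity.HubbardSuperconductivity.Theorems.KLProgrammeKLRegimeAlphaWtClosed
import Summits.HubbardSuperconductivity.HubbardSuperconductivity.Theorems.KLProgrammeKLRegimeAlphaWtSectionalRates
import Summits.HubbardSuperconductivity.HubbardSuperconductivity.Theorems.KLProgrammeKLRegimeAlphaWtSectionalScalars

/-!
# Route `KLProgramme` — engine / VL support, route (L2), FAT layer, WEIGHTED, SECTIONAL: **the uniform SECTIONAL per-pair bound in CLOSED FORM**
# at the engine's slice `(Λ, Λ′] = (klScale e₀ (m+1), Λ′]` — ε-FREE, Λ-FREE, L-FREE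

Cell `gate-hubbard-kl`, seat p3 (g11), for the «sectional row `eW′`» in the SECTOR currency (k3c4-p1 M3b-j (ii), `…TwoVolumeSrcSectorScaleSuccMinS`
hypothesis `hsecW'`).  The fixed-time twin of `…AlphaWtClosed.slicePairWt_bgmFat_closed` (file (α2b) of «W3α»): regime numerics and spatial rates
as there (`s₁ = 2Λ/(πX₁)`, `s₂`, `s₃`, `s₃′`; no time rate), `…AlphaWtSectionalRates.slicePairWt_bgmFat_sectional_raw` packaged by
`wBracketWt_le` (at `s₀ = 1`, `x₀ = 1`, `Mβ := Λ`), `fatCellCount_le` and `alphaProductWtSectional_le`: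

* **`slicePairWt_bgmFat_sectional_closed`** — for every pair `(ω, ω′)` and EVERY time difference `z₁`,
  `Σ_{z₂} (1 + s₁|z̃₂|₁)‖S[(βL²)⁻²F̃_ωF̃_{ω′}Ψ̂](z₁, z₂)‖ ≤ (64/π)·√(24·C_W¹·C_N¹)` with
  `C_W¹ = 64(1 + 5√2 + 5√2X₃)²·(4096·1·(4(2√2x₂+2)(2√2x₃+1)) + 160x₁(x₁+1)²/δ_L)` and `C_N¹ = 16c₁c_ρ/(π(2ρ_min − 4A))` — no `M/β`, no `1/Λ`:
  the sectional row is of order ONE where the all-times row (`slicePairWt_bgmFat_closed`) is `≍ (M/β)/Λ`.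

Everything is proved; no definitions. [cite: BenfattoGiulianiMastropietro2006, §2.8 (2.81), §3 (3.3)]
-/

noncomputable section

namespace Summit.HubbardSuperconductivity.HubbardSuperconductivity.Theorems.TorusFourierL2

set_option linter.dupNamespace false -- summit = problem name (single-conjunct summit), D-0017

open Set Finset Literature.MathematicalPhysics.QuantumLattice Literature.MathematicalPhysics.QuantumLattice.BandSectorCounting
open Literature.MathematicalPhysics.QuantumLattice.FermiRG Literature.Probability.LatticeModels Literature.Analysis.SpecialFunctions
open Summit.HubbardSuperconductivity.HubbardSuperconductivity.Theorems.DispersionFlow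
open Summit.HubbardSuperconductivity.HubbardSuperconductivity.Theorems.KLRegimeSplit
open Summit.HubbardSuperconductivity.HubbardSuperconductivity.Theorems.KLProgrammeLegKernels
open Summit.HubbardSuperconductivity.HubbardSuperconductivity.Theorems.PerturbedFermiCurve
open scoped Real Nat

section Closed

open Classical

variable {L M : ℕ} [NeZero L] [NeZero M] {a b : ℝ} (B : BandBounds a b) {K : TrigPolyC4v} {A : ℝ}
  (hA : ∀ p : Momentum, ∀ j ≤ 2, ‖iteratedFDeriv ℝ j (frameShift K) p‖ ≤ A) (hADt : 2 * A < B.Dtmin)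
  {μ e₀ z β : ℝ} (he : 0 < e₀) (hz : 0 < z) (hz1 : z ≤ 1) (hgap : e₀ + A + z ^ 2 < -μ) (h3 : e₀ + A - μ ≤ 3)
  (hlo : a ≤ μ - A - e₀) (hhi : μ + A + e₀ ≤ b) (hβ : 0 < β) (hρA : 4 * A < 2 * B.rhomin)
  (m : ℕ) (hMm : klScale e₀ m * β < π * (2 * M - 5))
  {d : ℝ} (hd : 0 ≤ d) (hd1 : ∀ u, |deriv (bgmCutoffSq e₀) u| ≤ d) (hd2 : ∀ u, |iteratedDeriv 2 (bgmCutoffSq e₀) u| ≤ d)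
  (hd3 : ∀ u, |iteratedDeriv 3 (bgmCutoffSq e₀) u| ≤ d)
  {A₃ a₃ : ℝ} (hA3 : ∀ p : Momentum, ‖iteratedFDeriv ℝ 3 (frameShift K) p‖ ≤ A₃) (ha3 : A₃ * klScale e₀ m ^ 2 ≤ a₃)
  {Ba : ℝ} (hB0 : 0 ≤ Ba)
  (hB : ∀ (i : ℕ), i ≤ 2 → ∀ (n : ℕ) (ω : ℤ) (θ₀ : ℝ) (q w : Fin 2 → ℝ) (t : ℝ) {r₀ : ℝ}, 0 < r₀ →
    r₀ ≤ ‖momToComplex (q + t • w)‖ → |sectorRelAngle θ₀ (q + t • w)| < π →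
    ‖iteratedDeriv i (fun t : ℝ => sectorWeightCirc n ω (polarAngle (q + t • w))) t‖ ≤
      (2 : ℕ)! * Ba * ((1 + (sectorWidth n)⁻¹ * (2 : ℕ)!) * ‖momToComplex w‖ / r₀) ^ i)
  {Ba3 : ℝ} (hB30 : 0 ≤ Ba3)
  (hB3 : ∀ (i : ℕ), i ≤ 3 → ∀ (n : ℕ) (ω : ℤ) (θ₀ : ℝ) (q w : Fin 2 → ℝ) (t : ℝ) {r₀ : ℝ}, 0 < r₀ →
    r₀ ≤ ‖momToComplex (q + t • w)‖ → |sectorRelAngle θ₀ (q + t • w)| < π →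
    ‖iteratedDeriv i (fun t : ℝ => sectorWeightCirc n ω (polarAngle (q + t • w))) t‖ ≤
      (3 : ℕ)! * Ba3 * ((1 + (sectorWidth n)⁻¹ * (3 : ℕ)!) * ‖momToComplex w‖ / r₀) ^ i)
  {Λ' : ℝ} (hΛΛ' : klScale e₀ (m + 1) ≤ Λ')
  {K₁ K₂ K₃ : ℝ} (hK₁pos : 0 < K₁) (hK₁ : ∀ p, ‖fderiv ℝ (frameLevel μ K) p‖ ≤ K₁) (hK₂ : ∀ p, ‖iteratedFDeriv ℝ 2 (frameLevel μ K) p‖ ≤ K₂)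
  (hK₃ : ∀ p, ‖iteratedFDeriv ℝ 3 (frameLevel μ K) p‖ ≤ K₃)
  {B₁ B₂ B₃ : ℝ} (hB₁ : ∀ x, |deriv salmhoferCutoff x| ≤ B₁) (hB₂ : ∀ x, |deriv (deriv salmhoferCutoff) x| ≤ B₂)
  (hB₃ : ∀ x, |deriv (deriv (deriv salmhoferCutoff)) x| ≤ B₃)
  -- regime
  (he₁ : e₀ ≤ 1) (hπβ : π ≤ klScale e₀ m * β)
  (hLz : 3 * |2 * π / L| * ((2 : ℝ) ^ (m + 1) + 1 / 2) ≤ z) (hLN : 2 * π * (2 : ℝ) ^ (m + 1) * ((2 : ℝ) ^ (m + 1) + 1 / 2) ≤ L)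
  (hL1 : (2 * B.rhomin - 4 * A) * π ≤ 2 * Real.sqrt 2 * L * klScale e₀ (m + 1))
  {R₀ : ℕ} (hR₀ : 2 * (2 * (2 : ℝ) ^ (m + 1) + 1) * (R₀ : ℝ) < L) (hR₀' : (L : ℝ) / (10 * (2 : ℝ) ^ (m + 1)) ≤ R₀)
  {δL : ℝ} (hδL : 0 < δL) (hΛL : δL ≤ klScale e₀ (m + 1) ^ 2 * L)
  -- the closed-form constants (instantiate with `rfl`)
  {cρ G₁ G₂ G₃ κ₃F Kp bτ ae1 ae2 av1 av2 qv q3e q3v X₁ X₃ x₁ x₂ x₃ c₁ CW CN : ℝ}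
  (hcρ : cρ = (2 * e₀ / π + B.smax * B.Dtmin * (3 / 4)) / (B.Dtmin - 2 * A) + π * Real.sqrt 2 * (1 + (4 + 2 * A) / (B.Dtmin - 2 * A)))
  (hG₁ : G₁ = d * e₀ ^ 2 * 1 + 1 * (d * e₀ ^ 2)) (hG₂ : G₂ = d * e₀ ^ 4 * 1 + 2 * (d * e₀ ^ 2) * (d * e₀ ^ 2) + 1 * (d * e₀ ^ 4))
  (hG₃ : G₃ = d * e₀ ^ 6 * 1 + 3 * (d * e₀ ^ 4) * (d * e₀ ^ 2) + 3 * (d * e₀ ^ 2) * (d * e₀ ^ 4) + 1 * (d * e₀ ^ 6))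
  (hκ₃F : κ₃F = (8 * G₃ + 12 * G₂) * (4 + 2 * A) ^ 3 + (12 * G₂ + 6 * G₁) * (4 + 2 * A) * (4 + 4 * A) * e₀ +
      2 * G₁ * (4 * e₀ ^ 2 + 8 * a₃) +
      216 * 9 * Ba3 * ((4 * G₂ + 2 * G₁) * (4 + 2 * A) ^ 2 * (2 * e₀) + 2 * G₁ * (4 + 4 * A) * e₀ * (2 * e₀)) +
      216 * 9 * G₁ * (4 + 2 * A) * (12 * Ba3 + 72 * Ba3 ^ 2) * (2 * e₀) ^ 2 + 216 * 9 * (12 * Ba3 + 216 * Ba3 ^ 2) * (2 * e₀) ^ 3)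
  (hKp : Kp = 4 + 4 * A) (hbτ : bτ = 4 + 2 * A + 2 * K₂ * (cρ * π))
  (hae1 : ae1 = G₁ * (4 + 2 * A + Kp * (cρ * π + 2)) / 2 + 72 * Ba * e₀)
  (hae2 : ae2 = (4 * G₂ + 2 * G₁) * (4 + 2 * A + Kp * (cρ * π + 2)) ^ 2 / 16 + G₁ * Kp * e₀ / 2 +
    144 * G₁ * (4 + 2 * A + Kp * (cρ * π + 2)) * Ba * e₀ + 36 * (4 * Ba + 8 * Ba ^ 2) * e₀ ^ 2)
  (hav1 : av1 = G₁ * (4 + 2 * A + Kp * (cρ * π + 2)) / (2 * e₀) + 288 * Ba)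
  (hav2 : av2 = (4 * G₂ + 2 * G₁) * (4 + 2 * A + Kp * (cρ * π + 2)) ^ 2 / (16 * e₀ ^ 2) + G₁ * Kp / (2 * e₀) +
    144 * G₁ * (4 + 2 * A + Kp * (cρ * π + 2)) * Ba / e₀ + 144 * (4 * Ba + 8 * Ba ^ 2))
  (hqv : qv = (32 * B₂ + 144 * B₁ + 128) * (bτ + 8 * K₂) ^ 2 / (4 * e₀ ^ 2) + (16 * B₁ + 16) * K₂ / (2 * e₀) +
    av1 * (16 * B₁ + 16) * (bτ + 6 * K₂) / (2 * e₀) + av2)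
  (hq3e : q3e = (64 * B₃ + 480 * B₂ + 1728 * B₁ + 1536) * (Real.sqrt 2 * K₁ + 12 * K₂) ^ 3 / 4 +
    3 / 2 * (32 * B₂ + 144 * B₁ + 128) * K₂ * (Real.sqrt 2 * K₁ + 12 * K₂) * e₀ + Real.sqrt 2 / 2 * (16 * B₁ + 16) * K₃ * e₀ ^ 2 +
    3 * ae1 * ((32 * B₂ + 144 * B₁ + 128) * (Real.sqrt 2 * K₁ + 10 * K₂) ^ 2 / 4 + (16 * B₁ + 16) * K₂ * e₀ / 2) +
    3 / 4 * ae2 * (16 * B₁ + 16) * (Real.sqrt 2 * K₁ + 8 * K₂) + κ₃F / 64)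
  (hq3v : q3v = (64 * B₃ + 480 * B₂ + 1728 * B₁ + 1536) * (bτ + 12 * K₂) ^ 3 / 4 +
    3 / 2 * (32 * B₂ + 144 * B₁ + 128) * K₂ * (bτ + 12 * K₂) * e₀ + Real.sqrt 2 / 2 * (16 * B₁ + 16) * K₃ * e₀ ^ 2 +
    3 * (e₀ * av1 / 2) * ((32 * B₂ + 144 * B₁ + 128) * (bτ + 10 * K₂) ^ 2 / 4 + (16 * B₁ + 16) * K₂ * e₀ / 2) +
    3 / 4 * (e₀ ^ 2 * av2) * (16 * B₁ + 16) * (bτ + 8 * K₂) + κ₃F / 64)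
  (hX₁ : X₁ = max 1 q3e) (hX₃ : X₃ = max 1 q3v)
  (hx₁ : x₁ = π * X₁ / 2) (hx₂ : x₂ = 5 * π / 4 * X₁) (hx₃ : x₃ = 5 * π / 4 * Real.sqrt qv)
  (hc₁ : c₁ = 4 + Kp * cρ ^ 2 * π ^ 2 / e₀)
  (hCW : CW = 64 * (1 + 5 * Real.sqrt 2 + 5 * Real.sqrt 2 * X₃) ^ 2 *
    (4096 * 1 * (4 * ((2 * Real.sqrt 2 * x₂ + 2) * (2 * Real.sqrt 2 * x₃ + 1)) + 160 * x₁ * (x₁ + 1) ^ 2 / δL)))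
  (hCN : CN = 16 * c₁ * cρ / (π * (2 * B.rhomin - 4 * A)))

include B hA hADt he hz hz1 hgap h3 hlo hhi hβ hρA hMm hd hd1 hd2 hd3 hA3 ha3 hB0 hB hB30 hB3 hΛΛ' hK₁pos hK₁ hK₂ hK₃ hB₁ hB₂ hB₃ he₁ hπβ
  hLz hLN hL1 hR₀ hR₀' hδL hΛL hcρ hG₁ hG₂ hG₃ hκ₃F hKp hbτ hae1 hae2 hav1 hav2 hqv hq3e hq3v hX₁ hX₃ hx₁ hx₂ hx₃ hc₁ hCW hCN

set_option maxHeartbeats 3000000 in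
/-- **The uniform SECTIONAL per-pair bound in closed form** (`≤ (64/π)·√(24·C_W¹·C_N¹)`, weight `1 + s₁|z̃₂|₁` with the canonical
spatial rate `s₁ = 2Λ/(πX₁)`, uniformly in the time difference; see the module docstring). [cite: BenfattoGiulianiMastropietro2006, §2.8 (2.81), §3 (3.3)] -/
theorem slicePairWt_bgmFat_sectional_closed (ω ω' : Fin (sectorCount (m + 1))) :
    ∀ z₁ : TorusSite 1 (2 * M), ∑ z₂ : TorusSite 2 L,
        (1 + 2 * klScale e₀ (m + 1) / (π * X₁) * |(((z₂ 0).valMinAbs : ℤ) : ℝ)| +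
            2 * klScale e₀ (m + 1) / (π * X₁) * |(((z₂ 1).valMinAbs : ℤ) : ℝ)|) *
        ‖∑ q : TorusSite 1 (2 * M) × TorusSite 2 L, (torusChar q.1 z₁ * torusChar q.2 z₂) •
          ((((1 / (β * (L : ℝ) ^ 2) : ℝ) : ℂ) ^ 2 *
            (bgmFatMultiplier L M e₀ β (nambuXiCT L μ K) (m + 1) ω (⟨(q.1 0).val, ZMod.val_lt (q.1 0)⟩, q.2) *
              bgmFatMultiplier L M e₀ β (nambuXiCT L μ K) (m + 1) ω' (⟨(q.1 0).val, ZMod.val_lt (q.1 0)⟩, q.2) *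
              sliceSymbolFnXi (β * (L : ℝ) ^ 2) 0 (klScale e₀ (m + 1)) Λ' (matsubaraFreq β M ⟨(q.1 0).val, ZMod.val_lt (q.1 0)⟩)
                (nambuXiCT L μ K q.2))))‖ ≤
      64 / π * Real.sqrt (24 * CW * CN) := by
  -- the scales and the tangent resolution
  have hπ := Real.pi_pos
  have hL : (0 : ℝ) < L := Nat.cast_pos.2 (Nat.pos_of_ne_zero (NeZero.ne L))
  set Λ : ℝ := klScale e₀ (m + 1) with hΛdef
  set Nr : ℝ := (2 : ℝ) ^ (m + 1) with hNrdef
  have hΛ : 0 < Λ := by rw [hΛdef, klScale]; positivity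
  have hNr2 : 2 ≤ Nr := by
    rw [hNrdef]
    calc (2 : ℝ) = 2 ^ 1 := by norm_num
      _ ≤ 2 ^ (m + 1) := pow_le_pow_right₀ (by norm_num) (by omega)
  have hNr0 : 0 < Nr := by linarith only [hNr2]
  have hNr1 : 1 ≤ Nr := by linarith only [hNr2]
  have hNrsq : Nr ^ 2 = (4 : ℝ) ^ (m + 1) := by
    rw [hNrdef, ← pow_mul, show (4 : ℝ) = 2 ^ 2 by norm_num, ← pow_mul]; ring_nf
  have hNrΛ : Nr ^ 2 * Λ = e₀ := by rw [hNrsq, hΛdef, klScale]; field_simp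
  have hΛm : klScale e₀ m = 4 * Λ := by rw [hΛdef, klScale, klScale, pow_succ]; field_simp
  have hΛm0 : 0 < klScale e₀ m := by rw [hΛm]; positivity
  have hΛe : Λ ≤ e₀ := klScale_le_e0 he.le (m + 1)
  have hΛ1 : Λ ≤ 1 := hΛe.trans he₁
  have hNrΛ' : Nr * Λ ≤ e₀ / 2 := by
    have : Nr * Λ = e₀ / Nr := by
      rw [eq_div_iff hNr0.ne', ← hNrΛ]; ring
    rw [this]; exact div_le_div_of_nonneg_left he.le (by norm_num) hNr2
  have hw : sectorWidth (m + 1) = π / Nr := by rw [sectorWidth, hNrdef]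
  have hwsi : 1 + 2 * (sectorWidth (m + 1))⁻¹ ≤ 2 * Nr := by
    rw [hw, inv_div]
    have : 2 * (Nr / π) ≤ Nr := by
      rw [mul_div_assoc']; rw [div_le_iff₀ hπ]; nlinarith only [Real.pi_gt_three, hNr0]
    linarith only [this, hNr2]
  have hwsi0 : 0 ≤ (sectorWidth (m + 1))⁻¹ := by rw [hw]; positivity
  -- constants: nonnegativity
  have hA0 : 0 ≤ A := (norm_nonneg _).trans (hA 0 0 (by norm_num))
  have hK10 : 0 ≤ K₁ := hK₁pos.le
  have hK20 : 0 ≤ K₂ := le_trans (norm_nonneg _) (hK₂ 0)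
  have hK30 : 0 ≤ K₃ := le_trans (norm_nonneg _) (hK₃ 0)
  have hB10 : 0 ≤ B₁ := (abs_nonneg _).trans (hB₁ 0)
  have hB20 : 0 ≤ B₂ := (abs_nonneg _).trans (hB₂ 0)
  have hB30' : 0 ≤ B₃ := (abs_nonneg _).trans (hB₃ 0)
  have hDt0 : 0 < B.Dtmin - 2 * A := by linarith only [hADt]
  have hγ : 0 < 2 * B.rhomin - 4 * A := by linarith only [hρA]
  have hcρ0 : 0 ≤ cρ := by rw [hcρ]; have := B.smax_pos; have := B.Dtmin_pos; positivity
  have hG₁0 : 0 ≤ G₁ := by rw [hG₁]; positivity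
  have hG₂0 : 0 ≤ G₂ := by rw [hG₂]; positivity
  have hG₃0 : 0 ≤ G₃ := by rw [hG₃]; positivity
  have hA30 : 0 ≤ A₃ := le_trans (norm_nonneg _) (hA3 0)
  have ha30 : 0 ≤ a₃ := le_trans (by positivity) ha3
  have hκ₃F0 : 0 ≤ κ₃F := by rw [hκ₃F]; positivity
  have hKp0 : 0 ≤ Kp := by rw [hKp]; positivity
  have hbτ0 : 0 ≤ bτ := by rw [hbτ]; positivity
  have hae10 : 0 ≤ ae1 := by rw [hae1]; positivity
  have hae20 : 0 ≤ ae2 := by rw [hae2]; positivity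
  have hav10 : 0 ≤ av1 := by rw [hav1]; positivity
  have hav20 : 0 ≤ av2 := by rw [hav2]; positivity
  have hqv0 : 0 < qv := by
    rw [hqv]
    have : 0 < (32 * B₂ + 144 * B₁ + 128) * (bτ + 8 * K₂) ^ 2 / (4 * e₀ ^ 2) := by
      have : 0 < bτ + 8 * K₂ := by rw [hbτ]; positivity
      positivity
    positivity
  obtain ⟨hX₁c, hX₁0⟩ := le_max_one_pow_three q3e
  obtain ⟨hX₃c, hX₃0⟩ := le_max_one_pow_three q3v
  rw [← hX₁] at hX₁c hX₁0
  rw [← hX₃] at hX₃c hX₃0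
  have hX₁1 : 1 ≤ X₁ := by rw [hX₁]; exact le_max_left _ _
  have hx₁0 : 0 < x₁ := by rw [hx₁]; positivity
  have hx₂0 : 0 ≤ x₂ := by rw [hx₂]; positivity
  have hx₃0 : 0 ≤ x₃ := by rw [hx₃]; positivity
  have hc₁0 : 0 ≤ c₁ := by rw [hc₁]; positivity
  have hCW0 : 0 ≤ CW := by rw [hCW]; positivity
  have hCN0 : 0 ≤ CN := by rw [hCN]; positivity
  -- the steps
  set ℓ₁ : ℝ := 2 * π / L with hℓ₁
  set ℓ : ℝ := 2 * π / L * (Nr + 1 / 2) with hℓ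
  have hℓ₁0 : 0 < ℓ₁ := by positivity
  have hℓ0 : 0 < ℓ := by positivity
  have hℓNr : ℓ * Nr ≤ 1 := by
    rw [hℓ, div_mul_eq_mul_div, div_mul_eq_mul_div, div_le_one hL]; linarith only [hLN]
  have hℓle1 : ℓ ≤ 1 := le_trans (le_mul_of_one_le_right hℓ0.le hNr1) hℓNr
  have hℓ₁ℓNr : ℓ₁ ≤ ℓ / Nr := by
    rw [hℓ, hℓ₁, le_div_iff₀ hNr0]
    exact mul_le_mul_of_nonneg_left (by linarith only []) (by positivity)
  have hℓ₁ℓ : ℓ₁ ≤ ℓ := hℓ₁ℓNr.trans (div_le_self hℓ0.le hNr1)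
  have hℓ₁le1 : ℓ₁ ≤ 1 := hℓ₁ℓ.trans hℓle1
  have habs : |2 * π / (L : ℝ)| = ℓ₁ := abs_of_pos hℓ₁0
  -- the cell radius
  set ρf : ℝ := (klScale e₀ m + B.smax * B.Dtmin * (3 * sectorWidth (m + 1) / 4)) / (B.Dtmin - 2 * A) +
    π * Real.sqrt 2 * (1 + (4 + 2 * A) / (B.Dtmin - 2 * A)) * sectorWidth (m + 1) with hρf
  have hρf0 : 0 ≤ ρf := by rw [hρf]; have := B.smax_pos; have := B.Dtmin_pos; have := sectorWidth_pos (m + 1); positivity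
  have hρfb : ρf ≤ cρ * π / Nr := by
    rw [hρf, hcρ, hw, hΛm]
    have h4Λ : 4 * Λ ≤ 2 * e₀ / π * (π / Nr) := by
      have e : 2 * e₀ / π * (π / Nr) = 2 * e₀ / Nr := by field_simp
      rw [e, le_div_iff₀ hNr0]
      have := mul_le_mul_of_nonneg_left hNrΛ' (by norm_num : (0:ℝ) ≤ 4)
      linarith only [this]
    have hsm := B.smax_pos; have hdt := B.Dtmin_pos
    have e2 : ((2 * e₀ / π + B.smax * B.Dtmin * (3 / 4)) / (B.Dtmin - 2 * A) + π * Real.sqrt 2 * (1 + (4 + 2 * A) / (B.Dtmin - 2 * A))) * π / Nr =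
        (2 * e₀ / π * (π / Nr) + B.smax * B.Dtmin * (3 * (π / Nr) / 4)) / (B.Dtmin - 2 * A) +
          π * Real.sqrt 2 * (1 + (4 + 2 * A) / (B.Dtmin - 2 * A)) * (π / Nr) := by
      field_simp
    rw [e2]
    gcongr
  -- shell thickness for the support count
  have hsh : klScale e₀ m + Kp * ρf ^ 2 ≤ Λ * c₁ := by
    rw [hΛm, hc₁]
    have h1 : ρf ^ 2 ≤ (cρ * π / Nr) ^ 2 := pow_le_pow_left₀ hρf0 hρfb 2
    have h2 : Kp * ρf ^ 2 ≤ Kp * (cρ * π / Nr) ^ 2 := mul_le_mul_of_nonneg_left h1 hKp0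
    have e : Λ * (4 + Kp * cρ ^ 2 * π ^ 2 / e₀) = 4 * Λ + Kp * (cρ * π / Nr) ^ 2 := by
      rw [← hNrΛ]; field_simp
    rw [e]; linarith only [h2]
  -- the rates
  set s₁ : ℝ := 2 * Λ / (π * X₁) with hs₁
  set s₂ : ℝ := 2 * Λ / (π * (Nr + 1 / 2) * X₁) with hs₂
  set s₃ : ℝ := 2 / (π * (Nr + 1 / 2) * Nr * Real.sqrt qv) with hs₃
  set s₃' : ℝ := 2 * Λ / (π * (Nr + 1 / 2) * X₃) with hs₃'
  have hsv : 0 < Real.sqrt qv := Real.sqrt_pos.2 hqv0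
  have hs₁0 : 0 < s₁ := by positivity
  have hs₂0 : 0 < s₂ := by positivity
  have hs₃0 : 0 < s₃ := by positivity
  have hs₃'0 : 0 < s₃' := by positivity
  have hsvsq : Real.sqrt qv ^ 2 = qv := Real.sq_sqrt hqv0.le
  have hT := slicePairWt_bgmFat_sectional_raw B hA hADt he hz hz1 hgap h3 hlo hhi hβ hρA m hMm hd hd1 hd2 hd3 hA3 ha3 hB0 hB hB30 hB3 hΛΛ'
    hK₁pos hK₁ hK₂ hK₃ hB₁ hB₂ hB₃ hLz hLN hR₀ hcρ hG₁ hG₂ hG₃ hκ₃F hKp hbτ hae1 hae2 hav1 hav2 hqv hq3e hq3v hX₁ hX₃ ω ω'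
  rw [← hΛdef, ← hNrdef] at hT
  intro z₁
  refine (hT z₁).trans ?_
  -- the rate bracket at `s₀ = 1` in closed form
  have h0 : 1 / (1 : ℝ) = 1 * Λ / Λ := by field_simp
  have h0' : (1 : ℝ) ≤ 1 / 1 := by norm_num
  have h1 : 1 / s₁ = x₁ / Λ := by rw [hs₁, hx₁]; field_simp
  have hratio : (Nr + 1 / 2) / (Nr - 1) ≤ 5 / 2 := by
    rw [div_le_iff₀ (by linarith only [hNr2])]; linarith only [hNr2]
  have hratio0 : 0 ≤ (Nr + 1 / 2) / (Nr - 1) := div_nonneg (by positivity) (by linarith only [hNr2])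
  have h2 : 1 / (s₂ * (Nr - 1)) ≤ x₂ / Λ := by
    rw [hs₂, hx₂]
    have e : 1 / (2 * Λ / (π * (Nr + 1 / 2) * X₁) * (Nr - 1)) = (π / 2 * X₁) * ((Nr + 1 / 2) / (Nr - 1)) / Λ := by
      field_simp
    rw [e]
    refine div_le_div_of_nonneg_right ?_ hΛ.le
    calc π / 2 * X₁ * ((Nr + 1 / 2) / (Nr - 1)) ≤ π / 2 * X₁ * (5 / 2) := mul_le_mul_of_nonneg_left hratio (by positivity)
      _ = 5 * π / 4 * X₁ := by ring
  have h3 : 1 / (s₃ * (Nr - 1)) ≤ x₃ * Nr := by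
    rw [hs₃, hx₃]
    have e : 1 / (2 / (π * (Nr + 1 / 2) * Nr * Real.sqrt qv) * (Nr - 1)) = (π / 2 * Real.sqrt qv) * ((Nr + 1 / 2) / (Nr - 1)) * Nr := by
      field_simp
    rw [e]
    refine mul_le_mul_of_nonneg_right ?_ hNr0.le
    calc π / 2 * Real.sqrt qv * ((Nr + 1 / 2) / (Nr - 1)) ≤ π / 2 * Real.sqrt qv * (5 / 2) := mul_le_mul_of_nonneg_left hratio (by positivity)
      _ = 5 * π / 4 * Real.sqrt qv := by ring
  have hf₂ : 2 * Real.sqrt 2 * s₁ / (s₂ * (Nr - 1)) ≤ 5 * Real.sqrt 2 := by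
    have e : 2 * Real.sqrt 2 * s₁ / (s₂ * (Nr - 1)) = 2 * Real.sqrt 2 * ((Nr + 1 / 2) / (Nr - 1)) := by rw [hs₁, hs₂]; field_simp
    rw [e]
    nlinarith only [hratio, Real.sqrt_nonneg 2]
  have hf₃ : 2 * Real.sqrt 2 * s₁ / (s₃' * (Nr - 1)) ≤ 5 * Real.sqrt 2 * X₃ := by
    have e : 2 * Real.sqrt 2 * s₁ / (s₃' * (Nr - 1)) = 2 * Real.sqrt 2 * ((Nr + 1 / 2) / (Nr - 1)) * (X₃ / X₁) := by
      rw [hs₁, hs₃']; field_simp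
    rw [e]
    have hXX : X₃ / X₁ ≤ X₃ := div_le_self hX₃0.le hX₁1
    have hXX0 : 0 ≤ X₃ / X₁ := by positivity
    calc 2 * Real.sqrt 2 * ((Nr + 1 / 2) / (Nr - 1)) * (X₃ / X₁) ≤ 2 * Real.sqrt 2 * (5 / 2) * X₃ := by gcongr
      _ = 5 * Real.sqrt 2 * X₃ := by ring
  have hW := wBracketWt_le (e₀ := e₀) (Mβ := Λ) (L := (L : ℝ)) one_pos hs₁0 hs₂0 hs₃0 hs₃'0 hΛ hΛe he₁ hNr2 hΛ.le zero_le_one hx₂0 hx₃0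
    hδL hL h0 h0' h1 h2 h3 hΛL hR₀' (by positivity) (by positivity) hf₂ hf₃
  have eCW : 64 * (1 + 5 * Real.sqrt 2 + 5 * Real.sqrt 2 * X₃) ^ 2 *
      (4096 * 1 * (4 * ((2 * Real.sqrt 2 * x₂ + 2) * (2 * Real.sqrt 2 * x₃ + 1)) + 160 * x₁ * (x₁ + 1) ^ 2 / δL) * Λ * Nr / Λ ^ 2) =
      CW * Nr / Λ := by rw [hCW]; field_simp
  rw [eCW] at hW
  have hY₁ : 2 ≤ Real.sqrt 2 * L * ((klScale e₀ m + (4 + 4 * A) * ρf ^ 2) / (2 * B.rhomin - 4 * A)) / π := by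
    have h1' : 2 ≤ Real.sqrt 2 * L * (klScale e₀ m / (2 * B.rhomin - 4 * A)) / π := by
      rw [hΛm, le_div_iff₀ hπ, mul_div_assoc', le_div_iff₀ hγ]; linarith only [hL1]
    refine h1'.trans ?_
    gcongr
    exact le_add_of_nonneg_right (by positivity)
  have hY₂ : 2 ≤ Real.sqrt 2 * L * (2 * ρf) / π := by
    have hlow : π * Real.sqrt 2 * (π / Nr) ≤ ρf := by
      rw [hρf, hw]
      have hsm := B.smax_pos; have hdt := B.Dtmin_pos
      have h1' : 0 ≤ (klScale e₀ m + B.smax * B.Dtmin * (3 * (π / Nr) / 4)) / (B.Dtmin - 2 * A) := by positivity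
      have h2' : π * Real.sqrt 2 * (π / Nr) ≤ π * Real.sqrt 2 * (1 + (4 + 2 * A) / (B.Dtmin - 2 * A)) * (π / Nr) := by
        have h1'' : (1 : ℝ) ≤ 1 + (4 + 2 * A) / (B.Dtmin - 2 * A) := by
          have : 0 ≤ (4 + 2 * A) / (B.Dtmin - 2 * A) := by positivity
          linarith only [this]
        have h2'' := mul_le_mul_of_nonneg_left h1'' (by positivity : 0 ≤ π * Real.sqrt 2 * (π / Nr))
        linarith only [h2'']
      linarith only [h1', h2']
    have hs2 : Real.sqrt 2 * Real.sqrt 2 = 2 := Real.mul_self_sqrt (by norm_num)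
    have hLNr : Nr ≤ 2 * L := by
      have h1'' : 1 ≤ 2 * π * (Nr + 1 / 2) := by nlinarith only [Real.pi_gt_three, hNr0]
      have h2'' : Nr ≤ 2 * π * Nr * (Nr + 1 / 2) := by
        calc Nr = Nr * 1 := (mul_one _).symm
          _ ≤ Nr * (2 * π * (Nr + 1 / 2)) := mul_le_mul_of_nonneg_left h1'' hNr0.le
          _ = 2 * π * Nr * (Nr + 1 / 2) := by ring
      linarith only [h2'', hLN, hL]
    rw [le_div_iff₀ hπ]
    calc 2 * π ≤ Real.sqrt 2 * L * (2 * (π * Real.sqrt 2 * (π / Nr))) := by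
          rw [show Real.sqrt 2 * L * (2 * (π * Real.sqrt 2 * (π / Nr))) = (Real.sqrt 2 * Real.sqrt 2) * 2 * π * π * L / Nr by field_simp, hs2]
          rw [le_div_iff₀ hNr0]
          have h1'' : 2 * π * Nr ≤ 2 * π * (2 * L) := mul_le_mul_of_nonneg_left hLNr (by positivity)
          have h2'' : 2 * π * (2 * L) ≤ 2 * 2 * π * π * L := by
            have h := mul_le_mul_of_nonneg_left (show (1 : ℝ) ≤ π by linarith only [Real.pi_gt_three])
              (by positivity : (0 : ℝ) ≤ 2 * 2 * π * L)
            linarith only [h]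
          linarith only [h1'', h2'']
      _ ≤ Real.sqrt 2 * L * (2 * ρf) := by gcongr
  have hNc := fatCellCount_le (Kp := 4 + 4 * A) hΛ hL hγ hNr0 hΛm (by rw [← hKp]; exact hsh) hρfb (by positivity) hY₁ hY₂
  rw [← hCN] at hNc
  -- the time-section count
  have hNt : klScale e₀ m * β / π + 3 ≤ 16 * Λ * β / π := by
    rw [hΛm] at hπβ ⊢
    have h1' : 1 ≤ 4 * Λ * β / π := by rw [le_div_iff₀ hπ]; linarith only [hπβ]
    have e : 16 * Λ * β / π = 4 * (4 * Λ * β / π) := by ring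
    rw [e]; linarith only [h1']
  have hW0 : 0 ≤ 524288 * (1 / (1 : ℝ) + 1) *
      ((1 + 2 * Real.sqrt 2 * s₁ / (s₂ * (Nr - 1)) + 2 * Real.sqrt 2 * s₁ / (s₃' * (Nr - 1))) ^ 2 *
          ((2 * Real.sqrt 2 / (s₂ * (Nr - 1)) + 2) * (2 * Real.sqrt 2 / (s₃ * (Nr - 1)) + 2)) + (1 / s₁ + 1) ^ 2 / (1 + s₁ * R₀)) := by
    have : 0 < Nr - 1 := by linarith only [hNr2]
    positivity
  have hNc0 : 0 ≤ (Real.sqrt 2 * L * ((klScale e₀ m + (4 + 4 * A) * ρf ^ 2) / (2 * B.rhomin - 4 * A)) / π + 2) * (Real.sqrt 2 * L * (2 * ρf) / π + 2) := by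
    positivity
  exact alphaProductWtSectional_le hW0 hNc0 hCW0 hCN0 hβ hL hΛ hNr0 hW hNc hNt

end Closed

end Summit.HubbardSuperconductivity.HubbardSuperconductivity.Theorems.TorusFourierL2

end
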